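import Summits.Ventures.PercRepro.ProfileGapMonoThresholdWeakAverageLoop

/-!
# PercRepro — PARALLEL CLASSES OF A LOOPLESS MATROID, IN THE FINSET VOCABULARY (p5, gen 27;
`proofs/P5-GM1.md` §27; tools for the parallel case of the weak averaged step at `(2, 3)`)

For a rank-`1` set `B` of a loopless matroid `N`, its PARALLEL CLASS is the flat `P = clF N B`: every nonempty
subset of `P` has rank `1`, every point of `P` lies in the closure of every other point of `P`, and a point outside
`P` raises the rank of `B` to `2`.  What the charging needs, all in terms of `rk`, `clF`, `coloops`:
* `mem_clF_iff_rk_insert`, `clF_mono`, `subset_clF`, `clF_subset_gr`, `rk_clF`, `rk_union_le`;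
* `rk_eq_one_of_subset_clF` (nonempty subsets of the class), `mem_clF_singleton_of_mem_clF` (two points of one class
  are parallel), `rk_insert_of_mem_clF_singleton` (a point whose parallel partner is present costs nothing),
  `rk_sdiff_le_rk_sdiff_clF_add_one` (`ρ(E ∖ A) ≤ ρ(E ∖ P) + 1`), `card_coloops_sdiff_le_filter_add_one` (at most
  one coloop of `E ∖ B` lies in the class).
-/

open scoped Matroid

namespace PercRepro.Cogirth

open Finset ThmH Skew Shadow Profile

variable {α : Type} [DecidableEq α] {M : Matroid α} [M.Finite]

section Closure

/-- Closure membership by the rank of the insertion. -/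
theorem mem_clF_iff_rk_insert {y : α} (hy : y ∈ gr M) {X : Finset α} (hX : X ⊆ gr M) :
    y ∈ clF M X ↔ rk M (insert y X) = rk M X := by
  have h := rk_insert_eq hy hX
  constructor
  · intro hc
    rw [if_pos hc] at h
    exact h
  · intro hr
    by_contra hc
    rw [if_neg hc] at h
    omega

omit [DecidableEq α] in
/-- `clF` is monotone. -/
theorem clF_mono {X Y : Finset α} (h : X ⊆ Y) : clF M X ⊆ clF M Y := by
  rw [← coe_subset, coe_clF, coe_clF]
  exact M.closure_subset_closure (coe_subset.2 h)

omit [DecidableEq α] in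
/-- A subset of the ground set lies in its closure. -/
theorem subset_clF {X : Finset α} (hX : X ⊆ gr M) : X ⊆ clF M X := by
  rw [← coe_subset, coe_clF]
  exact M.subset_closure (X : Set α) (by rw [← coe_gr]; exact coe_subset.2 hX)

omit [DecidableEq α] in
/-- The closure lies in the ground set. -/
theorem clF_subset_gr (X : Finset α) : clF M X ⊆ gr M := by
  rw [← coe_subset, coe_clF, coe_gr]
  exact M.closure_subset_ground (X : Set α)

omit [DecidableEq α] in
/-- The closure has the rank of the set. -/
theorem rk_clF (X : Finset α) : rk M (clF M X) = rk M X := by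
  unfold rk
  rw [coe_clF, Matroid.eRk_closure_eq]

/-- Subadditivity of the rank. -/
theorem rk_union_le (X Y : Finset α) : rk M (X ∪ Y) ≤ rk M X + rk M Y := by
  have := rk_union_add_rk_inter_le (M := M) X Y
  omega

end Closure

section ParallelClass

variable {N : Matroid α} [N.Finite]

omit [DecidableEq α] in
/-- In a loopless matroid a nonempty subset of a rank-`1` closure has rank `1`. -/
theorem rk_eq_one_of_subset_clF (hloop : ∀ x ∈ gr N, rk N {x} = 1) {B : Finset α}
    (h1 : rk N B = 1) {A : Finset α} (hA : A ⊆ clF N B) (hne : A.Nonempty) : rk N A = 1 := by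
  obtain ⟨a, ha⟩ := hne
  have hag : a ∈ gr N := clF_subset_gr B (hA ha)
  have hle : rk N A ≤ 1 := by
    have := rk_mono' (M := N) hA
    rw [rk_clF, h1] at this
    exact this
  have hge : 1 ≤ rk N A := by
    have := rk_mono' (M := N) (singleton_subset_iff.2 ha)
    rw [hloop a hag] at this
    exact this
  omega

/-- Two points of one rank-`1` closure are parallel: each lies in the closure of the other. -/
theorem mem_clF_singleton_of_mem_clF (hloop : ∀ x ∈ gr N, rk N {x} = 1) {B : Finset α}
    (h1 : rk N B = 1) {x x' : α} (hx : x ∈ clF N B) (hx' : x' ∈ clF N B) : x ∈ clF N {x'} := by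
  have hxg : x ∈ gr N := clF_subset_gr B hx
  have hx'g : x' ∈ gr N := clF_subset_gr B hx'
  rw [mem_clF_iff_rk_insert hxg (singleton_subset_iff.2 hx'g), hloop x' hx'g]
  exact rk_eq_one_of_subset_clF hloop h1 (insert_subset hx (singleton_subset_iff.2 hx')) ⟨x, mem_insert_self _ _⟩

/-- A point whose parallel partner is present costs no rank. -/
theorem rk_insert_of_mem_clF_singleton {x x' : α} (hx : x ∈ gr N) (hxx' : x ∈ clF N {x'}) {X : Finset α}
    (hX : X ⊆ gr N) (hx'X : x' ∈ X) : rk N (insert x X) = rk N X := by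
  rw [← mem_clF_iff_rk_insert hx hX]
  exact clF_mono (singleton_subset_iff.2 hx'X) hxx'

/-- `ρ(E ∖ A) ≤ ρ(E ∖ P) + 1` for every `A`, `P = clF N B` a rank-`1` closure. -/
theorem rk_sdiff_le_rk_sdiff_clF_add_one {B : Finset α} (h1 : rk N B = 1) (A : Finset α) :
    rk N (gr N \ A) ≤ rk N (gr N \ clF N B) + 1 := by
  have hU : gr N \ A ⊆ (gr N \ clF N B) ∪ (clF N B \ A) := by
    intro x hx
    rw [mem_sdiff] at hx
    rw [mem_union, mem_sdiff, mem_sdiff]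
    by_cases hc : x ∈ clF N B
    · exact Or.inr ⟨hc, hx.2⟩
    · exact Or.inl ⟨hx.1, hc⟩
  have h2 : rk N (clF N B \ A) ≤ 1 := by
    have := rk_mono' (M := N) (sdiff_subset : clF N B \ A ⊆ clF N B)
    rw [rk_clF, h1] at this
    exact this
  have h3 := rk_mono' (M := N) hU
  have h4 := rk_union_le (M := N) (gr N \ clF N B) (clF N B \ A)
  omega

/-- At most one coloop of `E ∖ B` lies in the class of `B`:
`#coloops(E ∖ B) ≤ #{coloops of E ∖ B outside clF N B} + 1`. -/
theorem card_coloops_sdiff_le_filter_add_one (hloop : ∀ x ∈ gr N, rk N {x} = 1) {B : Finset α}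
    (h1 : rk N B = 1) :
    (coloops N (gr N \ B)).card ≤
      ((coloops N (gr N \ B)).filter (fun y => y ∉ clF N B)).card + 1 := by
  have hsplit := card_filter_add_card_filter_not (s := coloops N (gr N \ B)) (fun y => y ∉ clF N B)
  have hle : ((coloops N (gr N \ B)).filter (fun y => ¬ (y ∉ clF N B))).card ≤ 1 := by
    rw [card_le_one]
    intro x hx x' hx'
    rw [mem_filter, not_not] at hx hx'
    by_contra hne
    -- `x'` lies in `(E ∖ B) ∖ x`, and `x ∈ clF {x'}`, so `x` is not a coloop of `E ∖ B`
    have hxK := hx.1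
    have hx'K := hx'.1
    rw [mem_coloops] at hxK hx'K
    have hx'e : x' ∈ (gr N \ B).erase x := mem_erase.2 ⟨fun h => hne h.symm, hx'K.1⟩
    have hpar := mem_clF_singleton_of_mem_clF hloop h1 hx.2 hx'.2
    exact hxK.2 (clF_mono (singleton_subset_iff.2 hx'e) hpar)
  omega

end ParallelClass

end PercRepro.Cogirth
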